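import Mathlib
import HarnessLib
import Literature.Analysis.FluidPDE.TypeIAncientMildClassical
import Literature.Analysis.FluidPDE.ClassicalLocalEnergyCutoff
import Literature.Analysis.FluidPDE.SpaceTimeMollifier

/-!
# Route SymmetryModuliCount — crux `FarPastLedger` (stmt-NavierStokesRegularity-14060),
  line `uloc-gronwall-transplant`, stub PIN `stub_fplPinning`: tools

Support file (helper lemmas only, prefixed `fpl_PIN_`) for the Theorems file
`SymmetryModuliCountFarPastLedgerPinning`, which proves the registered stub `stub_fplPinning`
(PIN) of line `uloc-gronwall-transplant` of the crux item stmt-NavierStokesRegularity-14060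
(`Summit.NavierStokesRegularity.NavierStokesRegularity.Theses.SymmetryModuliCount.FarPastLedger`).

Contents (on `EuclideanSpace ℝ (Fin 3)`; `θ` a Mathlib bump at the origin, `θ_r = θ(·/r)`):

* scaled bumps: smoothness, support, mass `∫ θ_r = r³ ∫ θ`, `D θ_r = r⁻¹ (Dθ)(·/r)`,
  `Δ θ_r = r⁻² (Δθ)(·/r)`, hence `‖Dθ_r‖₁ = r² ‖Dθ‖₁`, `‖Δθ_r‖₁ = r ‖Δθ‖₁`;
* integration by parts onto a scalar weight, vector-valued forms of the tree's identities
  `integral_inner_laplacian_comm` and `integral_inner_convect_add_eq_zero`: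
  `∫ φ Δw = ∫ (Δφ) w`, and `∫ φ (w·∇)w = −∫ (Dφ(w)) w` for `div w = 0`;
* the momentum equation of a classical solution paired with a scalar weight,
  `∫ φ ∇p + ∫ φ ∂ₜu = ν ∫ φ Δu − ∫ φ (u·∇)u`, the continuity in time of `∫ φ ∇p(t)` and
  `∫ φ ∂ₜu(t)`, and `∫_{t₁}^{t₂} ∫ φ ∂ₜu = ∫ φ (u(t₂) − u(t₁))` (differentiation under the integral
  sign, the tree's `hasDerivAt_integral_of_support_subset`, and the fundamental theorem of
  calculus).

No published source is followed (elementary calculus around tree lemmas).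
-/

noncomputable section

open MeasureTheory Set Filter Metric Function
open _root_.Topology
open scoped Laplacian RealInnerProductSpace ContDiff
open Literature.Analysis.FluidPDE

-- the summit and its single sub-problem share the name (CONVENTIONS §1), as in every Theorems file
set_option linter.dupNamespace false -- nested layout Summit.<S>.<Sub>, Sub = S (D-0017)

namespace Summit.NavierStokesRegularity.NavierStokesRegularity.Theorems

/-! ### Scaled bumps `θ_r = θ(·/r)` -/

section Bump

variable (θ : ContDiffBump (0 : EuclideanSpace ℝ (Fin 3))) {r : ℝ}

/-- The scaled bump `θ(·/r)` is smooth. [folklore] -/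
theorem fpl_PIN_contDiff_scaled {n : ℕ∞} (r : ℝ) : ContDiff ℝ n fun x => θ (r⁻¹ • x) :=
  θ.contDiff.comp (contDiff_const_smul _)

/-- The scaled bump `θ(·/r)`, `r > 0`, vanishes off the closed ball of radius `θ.rOut * r`.
[folklore] -/
theorem fpl_PIN_scaled_eq_zero (hr : 0 < r) {x : EuclideanSpace ℝ (Fin 3)}
    (hx : x ∉ closedBall 0 (θ.rOut * r)) : θ (r⁻¹ • x) = 0 := by
  refine θ.zero_of_le_dist ?_
  rw [mem_closedBall, dist_zero_right, not_le] at hx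
  rw [dist_zero_right, norm_smul, norm_inv, Real.norm_of_nonneg hr.le, inv_mul_eq_div,
    le_div_iff₀ hr]
  exact hx.le

/-- The scaled bump has compact support. [folklore] -/
theorem fpl_PIN_hasCompactSupport_scaled (hr : 0 < r) :
    HasCompactSupport fun x => θ (r⁻¹ • x) :=
  HasCompactSupport.intro (isCompact_closedBall 0 (θ.rOut * r))
    fun _ hx => fpl_PIN_scaled_eq_zero θ hr hx

/-- Mass of the scaled bump: `∫ θ(x/r) dx = r³ ∫ θ`. [folklore] -/
theorem fpl_PIN_integral_scaled (hr : 0 < r) :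
    ∫ x, θ (r⁻¹ • x) = r ^ 3 * ∫ x, θ x := by
  have h := Measure.integral_comp_inv_smul_of_nonneg volume (⇑θ) hr.le
  rw [finrank_euclideanSpace_fin, smul_eq_mul] at h
  exact h

/-- Change of variables for a scaled integrand: `∫ g(x/r) dx = r³ ∫ g`. [folklore] -/
theorem fpl_PIN_integral_comp_inv_smul (g : EuclideanSpace ℝ (Fin 3) → ℝ) (hr : 0 < r) :
    ∫ x, g (r⁻¹ • x) = r ^ 3 * ∫ x, g x := by
  have h := Measure.integral_comp_inv_smul_of_nonneg volume g hr.le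
  rw [finrank_euclideanSpace_fin, smul_eq_mul] at h
  exact h

/-- Derivative of the scaled bump: `D(θ(·/r))(x) = r⁻¹ Dθ(x/r)`. [folklore] -/
theorem fpl_PIN_fderiv_scaled (r : ℝ) (x : EuclideanSpace ℝ (Fin 3)) :
    fderiv ℝ (fun y => θ (r⁻¹ • y)) x = r⁻¹ • fderiv ℝ θ (r⁻¹ • x) :=
  fderiv_comp_smul r⁻¹

/-- Laplacian of the scaled bump: `Δ(θ(·/r))(x) = r⁻² (Δθ)(x/r)`. [folklore] -/
theorem fpl_PIN_laplacian_scaled (r : ℝ) (x : EuclideanSpace ℝ (Fin 3)) :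
    (Δ (fun y => θ (r⁻¹ • y))) x = (r⁻¹) ^ 2 * (Δ ⇑θ) (r⁻¹ • x) := by
  have h := laplacian_comp_smul (θ.contDiff (n := 2)) r⁻¹ x
  rw [smul_eq_mul] at h
  exact h

/-- `L¹` norm of the gradient of the scaled bump: `∫ ‖D(θ(·/r))‖ = r² ∫ ‖Dθ‖`. [folklore] -/
theorem fpl_PIN_integral_norm_fderiv_scaled (hr : 0 < r) :
    ∫ x, ‖fderiv ℝ (fun y => θ (r⁻¹ • y)) x‖ = r ^ 2 * ∫ x, ‖fderiv ℝ θ x‖ := by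
  have e : (fun x => ‖fderiv ℝ (fun y => θ (r⁻¹ • y)) x‖) =
      fun x => r⁻¹ * ‖fderiv ℝ θ (r⁻¹ • x)‖ := by
    funext x
    rw [fpl_PIN_fderiv_scaled, norm_smul, norm_inv, Real.norm_of_nonneg hr.le]
  have h2 := fpl_PIN_integral_comp_inv_smul (fun x => ‖fderiv ℝ θ x‖) hr
  have h3 : r ^ 3 = r * r ^ 2 := by ring
  rw [e, integral_const_mul, h2, h3, mul_assoc, inv_mul_cancel_left₀ hr.ne']

/-- `L¹` norm of the Laplacian of the scaled bump: `∫ |Δ(θ(·/r))| = r ∫ |Δθ|`. [folklore] -/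
theorem fpl_PIN_integral_abs_laplacian_scaled (hr : 0 < r) :
    ∫ x, |(Δ (fun y => θ (r⁻¹ • y))) x| = r * ∫ x, |(Δ ⇑θ) x| := by
  have e : (fun x => |(Δ (fun y => θ (r⁻¹ • y))) x|) =
      fun x => (r⁻¹) ^ 2 * |(Δ ⇑θ) (r⁻¹ • x)| := by
    funext x
    rw [fpl_PIN_laplacian_scaled, abs_mul, abs_of_nonneg (sq_nonneg _)]
  have h2 := fpl_PIN_integral_comp_inv_smul (fun x => |(Δ ⇑θ) x|) hr
  have h3 : r⁻¹ ^ 2 * (r ^ 3 * ∫ x, |(Δ ⇑θ) x|) =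
      (r⁻¹ * r) ^ 2 * (r * ∫ x, |(Δ ⇑θ) x|) := by ring
  rw [e, integral_const_mul, h2, h3, inv_mul_cancel₀ hr.ne', one_pow, one_mul]

end Bump

/-! ### Integration by parts onto a scalar weight (vector-valued forms) -/

section IBP

variable {E : Type*} [NormedAddCommGroup E] [InnerProductSpace ℝ E] [FiniteDimensional ℝ E]
  [MeasurableSpace E] [BorelSpace E]

/-- Pairing a continuous field with a continuous compactly supported scalar weight is
integrable. [folklore] -/
theorem fpl_PIN_integrable_smul_of_hasCompactSupport {φ : E → ℝ} {v : E → E} (hφ : Continuous φ)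
    (hφc : HasCompactSupport φ) (hv : Continuous v) :
    Integrable (fun x => φ x • v x) (volume : Measure E) :=
  (hφ.smul hv).integrable_of_hasCompactSupport
    (HasCompactSupport.intro hφc fun x hx => by
      show φ x • v x = 0
      rw [image_eq_zero_of_notMem_tsupport hx, zero_smul])

/-- **Green's second identity onto a scalar weight**, vector-valued form: for `φ ∈ C²_c` and a
`C²` field `w`, `∫ φ Δw = ∫ (Δφ) w` (from the tree's `integral_inner_laplacian_comm`, paired with
constant vectors). [folklore] -/
theorem fpl_PIN_integral_smul_laplacian {φ : E → ℝ} {w : E → E} (hφ : ContDiff ℝ 2 φ)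
    (hφc : HasCompactSupport φ) (hw : ContDiff ℝ 2 w) :
    ∫ x, φ x • (Δ w) x = ∫ x, (Δ φ) x • w x := by
  have hΔφc : HasCompactSupport (Δ φ) :=
    HasCompactSupport.intro hφc fun x hx => laplacian_eq_zero_of_notMem_tsupport hx
  have i1 : Integrable (fun x => φ x • (Δ w) x) (volume : Measure E) :=
    fpl_PIN_integrable_smul_of_hasCompactSupport hφ.continuous hφc (continuous_laplacian hw)
  have i2 : Integrable (fun x => (Δ φ) x • w x) (volume : Measure E) :=
    fpl_PIN_integrable_smul_of_hasCompactSupport (continuous_laplacian hφ) hΔφc hw.continuous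
  refine ext_inner_left ℝ fun e => ?_
  rw [← integral_inner i1, ← integral_inner i2]
  have hψ : ContDiff ℝ 2 fun y => φ y • e := hφ.smul contDiff_const
  have hψc : HasCompactSupport fun y => φ y • e :=
    HasCompactSupport.intro hφc fun x hx => by
      rw [image_eq_zero_of_notMem_tsupport hx, zero_smul]
  have key := integral_inner_laplacian_comm hw hψ hψc
  have h1 : ∀ x, ⟪e, φ x • (Δ w) x⟫ = ⟪(Δ w) x, φ x • e⟫ := fun x => by
    rw [real_inner_smul_right, real_inner_smul_right, real_inner_comm]
  have h2 : ∀ x, ⟪e, (Δ φ) x • w x⟫ = ⟪w x, (Δ (fun y => φ y • e)) x⟫ := fun x => by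
    rw [laplacian_smul_const hφ e x, real_inner_smul_right, real_inner_smul_right, real_inner_comm]
  simp_rw [h1, h2]
  exact key

/-- **The transport term onto a scalar weight**, vector-valued form: for `φ ∈ C¹_c` and a `C¹`
divergence-free field `w`, `∫ φ (w·∇)w = −∫ (Dφ(w)) w` (from the tree's trilinear identity
`integral_inner_convect_add_eq_zero`, paired with constant vectors). [folklore] -/
theorem fpl_PIN_integral_smul_convect {φ : E → ℝ} {w : E → E} (hφ : ContDiff ℝ 1 φ)
    (hφc : HasCompactSupport φ) (hw : ContDiff ℝ 1 w) (hdiv : VectorCalculus.IsDivFree w) :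
    ∫ x, φ x • convect w w x = -∫ x, (fderiv ℝ φ x (w x)) • w x := by
  have hDw : Continuous (fderiv ℝ w) := hw.continuous_fderiv one_ne_zero
  have hDφ : Continuous (fderiv ℝ φ) := hφ.continuous_fderiv one_ne_zero
  have i1 : Integrable (fun x => φ x • convect w w x) (volume : Measure E) :=
    fpl_PIN_integrable_smul_of_hasCompactSupport hφ.continuous hφc (hDw.clm_apply hw.continuous)
  have i2 : Integrable (fun x => (fderiv ℝ φ x (w x)) • w x) (volume : Measure E) := by
    refine ((hDφ.clm_apply hw.continuous).smul hw.continuous).integrable_of_hasCompactSupport ?_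
    refine HasCompactSupport.intro (hφc.fderiv (𝕜 := ℝ)) fun x hx => ?_
    show (fderiv ℝ φ x (w x)) • w x = 0
    rw [image_eq_zero_of_notMem_tsupport hx, zero_apply, zero_smul]
  refine ext_inner_left ℝ fun e => ?_
  rw [inner_neg_right, ← integral_inner i1, ← integral_inner i2]
  have hψ : ContDiff ℝ 1 fun y => φ y • e := hφ.smul contDiff_const
  have hψc : HasCompactSupport fun y => φ y • e :=
    HasCompactSupport.intro hφc fun x hx => by
      rw [image_eq_zero_of_notMem_tsupport hx, zero_smul]
  have key := integral_inner_convect_add_eq_zero hw hw hψ hψc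
  have hz : ∫ x, VectorCalculus.divergence w x * ⟪w x, φ x • e⟫ = 0 := by
    simp [hdiv _]
  rw [hz, add_zero] at key
  have h1 : ∀ x, ⟪e, φ x • convect w w x⟫ = ⟪convect w w x, φ x • e⟫ := fun x => by
    rw [real_inner_smul_right, real_inner_smul_right, real_inner_comm]
  have h2 : ∀ x, ⟪e, (fderiv ℝ φ x (w x)) • w x⟫ = ⟪w x, convect w (fun y => φ y • e) x⟫ := by
    intro x
    rw [convect_apply, fderiv_smul_const (hφ.differentiable one_ne_zero x) e,
      ContinuousLinearMap.smulRight_apply, real_inner_smul_right, real_inner_smul_right,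
      real_inner_comm]
  simp_rw [h1, h2]
  linarith

end IBP

/-! ### The momentum equation paired with a scalar weight; time integration -/

section Classical

variable {E : Type*} [NormedAddCommGroup E] [InnerProductSpace ℝ E] [FiniteDimensional ℝ E]
  [MeasurableSpace E] [BorelSpace E]
variable {S : Set ℝ} {ν : ℝ} {u : ℝ → E → E} {p : ℝ → E → ℝ}

/-- **The momentum equation paired with a scalar weight** (unforced system): at every time
`t ∈ S`, `∫ φ ∇p + ∫ φ ∂ₜu = ν ∫ φ Δu − ∫ φ (u·∇)u` for a continuous compactly supported `φ`.
[folklore] -/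
theorem fpl_PIN_integral_smul_gradient_add (h : IsClassicalNSSolutionOn S ν 0 u p)
    (hS : UniqueDiffOn ℝ S) {t : ℝ} (ht : t ∈ S) {φ : E → ℝ} (hφ : Continuous φ)
    (hφc : HasCompactSupport φ) :
    (∫ x, φ x • gradient (p t) x) + ∫ x, φ x • timeDerivWithin S u t x =
      ν • (∫ x, φ x • (Δ (u t)) x) - ∫ x, φ x • convect (u t) (u t) x := by
  have hu2 : ContDiff ℝ 2 (u t) := (h.contDiff_velocity ht).of_le (by norm_cast)
  have hu1 : ContDiff ℝ 1 (u t) := (h.contDiff_velocity ht).of_le (by norm_cast)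
  have hp1 : ContDiff ℝ 1 (p t) := (h.contDiff_pressure ht).of_le (by norm_cast)
  have hdt : Continuous (timeDerivWithin S u t) :=
    ((h.smooth_velocity.timeDerivWithin hS).contDiff_slice ht).continuous
  have hconv : Continuous fun x => convect (u t) (u t) x :=
    (hu1.continuous_fderiv one_ne_zero).clm_apply hu1.continuous
  have i1 := fpl_PIN_integrable_smul_of_hasCompactSupport hφ hφc
    (continuous_gradient_of_contDiff hp1)
  have i2 := fpl_PIN_integrable_smul_of_hasCompactSupport hφ hφc hdt
  have i3 := fpl_PIN_integrable_smul_of_hasCompactSupport hφ hφc (continuous_laplacian hu2)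
  have i4 := fpl_PIN_integrable_smul_of_hasCompactSupport hφ hφc hconv
  have key : ∀ x, φ x • gradient (p t) x + φ x • timeDerivWithin S u t x =
      ν • (φ x • (Δ (u t)) x) - φ x • convect (u t) (u t) x := by
    intro x
    have hm := h.momentum t ht x
    simp only [Pi.zero_apply, add_zero] at hm
    rw [eq_sub_iff_add_eq] at hm
    rw [← smul_add, smul_comm ν (φ x), ← smul_sub]
    congr 1
    rw [eq_sub_iff_add_eq, ← hm]
    abel
  rw [← integral_add i1 i2, ← integral_smul, ← integral_sub (i3.fun_smul ν) i4]
  exact integral_congr_ae (Eventually.of_forall key)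

/-- The weighted pressure gradient `s ↦ ∫ φ ∇p(s)` is continuous on the time set. [folklore] -/
theorem fpl_PIN_continuousOn_integral_smul_gradient {f : ℝ → E → E}
    (h : IsClassicalNSSolutionOn S ν f u p) (hS : UniqueDiffOn ℝ S) {φ : E → ℝ} (hφ : Continuous φ)
    (hφc : HasCompactSupport φ) :
    ContinuousOn (fun s => ∫ x, φ x • gradient (p s) x) S := by
  refine continuousOn_integral_of_support_subset (μ := volume) (K := tsupport φ) hφc ?_ ?_
  · have h1 : ContinuousOn (fun z : ℝ × E => fderiv ℝ (p z.1) z.2) (S ×ˢ univ) :=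
      h.smooth_pressure.continuousOn_fderiv_slice hS
    have h2 : ContinuousOn (fun z : ℝ × E => gradient (p z.1) z.2) (S ×ˢ univ) :=
      (InnerProductSpace.toDual ℝ E).symm.continuous.comp_continuousOn h1
    have h3 : ContinuousOn (fun z : ℝ × E => φ z.2) (S ×ˢ univ) :=
      (hφ.comp continuous_snd).continuousOn
    exact h3.smul h2
  · intro s _ x hx
    show φ x • gradient (p s) x = 0
    rw [image_eq_zero_of_notMem_tsupport hx, zero_smul]

/-- The weighted time derivative `s ↦ ∫ φ ∂ₜu(s)` is continuous on the time set. [folklore] -/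
theorem fpl_PIN_continuousOn_integral_smul_timeDeriv {f : ℝ → E → E}
    (h : IsClassicalNSSolutionOn S ν f u p) (hS : UniqueDiffOn ℝ S) {φ : E → ℝ} (hφ : Continuous φ)
    (hφc : HasCompactSupport φ) :
    ContinuousOn (fun s => ∫ x, φ x • timeDerivWithin S u s x) S := by
  refine continuousOn_integral_of_support_subset (μ := volume) (K := tsupport φ) hφc ?_ ?_
  · have h1 := h.smooth_velocity.continuousOn_timeDerivWithin hS
    have h3 : ContinuousOn (fun z : ℝ × E => φ z.2) (S ×ˢ univ) :=
      (hφ.comp continuous_snd).continuousOn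
    exact h3.smul h1
  · intro s _ x hx
    show φ x • timeDerivWithin S u s x = 0
    rw [image_eq_zero_of_notMem_tsupport hx, zero_smul]

/-- **`d/dt ∫ φ u(t) = ∫ φ ∂ₜu(t)`** on an open time set (differentiation under the integral
sign, the tree's `hasDerivAt_integral_of_support_subset`). [folklore] -/
theorem fpl_PIN_hasDerivAt_integral_smul {f : ℝ → E → E} (h : IsClassicalNSSolutionOn S ν f u p)
    (hS : IsOpen S) {φ : E → ℝ} (hφ : ContDiff ℝ ∞ φ) (hφc : HasCompactSupport φ) {t : ℝ}
    (ht : t ∈ S) :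
    HasDerivAt (fun s => ∫ x, φ x • u s x) (∫ x, φ x • timeDerivWithin S u t x) t := by
  have hΦ : IsSmoothSpaceTimeOn S fun s x => φ x • u s x :=
    (isSmoothSpaceTimeOn_const_time hφ S).smul h.smooth_velocity
  have hsupp : ∀ s ∈ S, ∀ x ∉ tsupport φ, φ x • u s x = 0 := fun s _ x hx => by
    rw [image_eq_zero_of_notMem_tsupport hx, zero_smul]
  have hD := hasDerivAt_integral_of_support_subset (μ := volume) hS hΦ hφc hsupp ht
  have e2 : ∫ x, deriv (fun s => φ x • u s x) t = ∫ x, φ x • timeDerivWithin S u t x := by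
    refine integral_congr_ae (Eventually.of_forall fun x => ?_)
    have hl := h.smooth_velocity.hasDerivAt_timeLine hS ht x
    show deriv (fun s => φ x • u s x) t = φ x • timeDerivWithin S u t x
    rw [deriv_fun_const_smul (φ x) hl.differentiableAt, timeDerivWithin_eq_deriv hS ht u x]
  rw [e2] at hD
  exact hD

/-- **`∫_{t₁}^{t₂} ∫ φ ∂ₜu = ∫ φ (u(t₂) − u(t₁))`** for `[t₁, t₂]` inside an open time set
(fundamental theorem of calculus for `t ↦ ∫ φ u(t)`). [folklore] -/
theorem fpl_PIN_intervalIntegral_integral_smul_timeDeriv {f : ℝ → E → E}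
    (h : IsClassicalNSSolutionOn S ν f u p) (hS : IsOpen S) {φ : E → ℝ} (hφ : ContDiff ℝ ∞ φ)
    (hφc : HasCompactSupport φ) {t₁ t₂ : ℝ} (h12 : t₁ ≤ t₂) (hI : Icc t₁ t₂ ⊆ S) :
    ∫ s in t₁..t₂, (∫ x, φ x • timeDerivWithin S u s x) =
      ∫ x, φ x • (u t₂ x - u t₁ x) := by
  have hI' : uIcc t₁ t₂ ⊆ S := by rwa [uIcc_of_le h12]
  have hFTC := intervalIntegral.integral_eq_sub_of_hasDerivAt
    (fun s hs => fpl_PIN_hasDerivAt_integral_smul h hS hφ hφc (hI' hs))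
    ((fpl_PIN_continuousOn_integral_smul_timeDeriv h hS.uniqueDiffOn hφ.continuous hφc).mono
      hI').intervalIntegrable
  rw [hFTC]
  have i1 := fpl_PIN_integrable_smul_of_hasCompactSupport hφ.continuous hφc
    (h.contDiff_velocity (hI (right_mem_Icc.2 h12))).continuous
  have i2 := fpl_PIN_integrable_smul_of_hasCompactSupport hφ.continuous hφc
    (h.contDiff_velocity (hI (left_mem_Icc.2 h12))).continuous
  rw [← integral_sub i1 i2]
  refine integral_congr_ae (Eventually.of_forall fun x => ?_)
  simp only [smul_sub]

end Classical

/-! ### The registered sub-goal of this tools file -/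

section Registered

/-- **Registered sub-goal `stub_fplPinningTools` (principal theorem of this tools file)**: for a
classical solution of the unforced unit-viscosity system on the window `(t₀, 0)` and a smooth
compactly supported weight `φ`, `∫_{t₁}^{t₂} ∫ φ ∂ₜu = ∫ φ (u(t₂) − u(t₁))` whenever
`t₀ < t₁ ≤ t₂ < 0` (the time-derivative term of the bump-averaged momentum equation is the mean
displacement; `fpl_PIN_intervalIntegral_integral_smul_timeDeriv` on `ℝ³`). [folklore] -/
theorem stub_fplPinningTools :
    ∀ (t₀ : ℝ) (u : ℝ → EuclideanSpace ℝ (Fin 3) → EuclideanSpace ℝ (Fin 3))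
      (p : ℝ → EuclideanSpace ℝ (Fin 3) → ℝ),
    Literature.Analysis.FluidPDE.IsClassicalNSSolutionOn (Set.Ioo t₀ 0) 1 0 u p →
    ∀ (φ : EuclideanSpace ℝ (Fin 3) → ℝ), ContDiff ℝ (⊤ : ℕ∞) φ → HasCompactSupport φ →
    ∀ (t₁ t₂ : ℝ), t₀ < t₁ → t₁ ≤ t₂ → t₂ < 0 →
    ∫ s in t₁..t₂, (∫ x, φ x •
        Literature.Analysis.FluidPDE.timeDerivWithin (Set.Ioo t₀ 0) u s x) =
      ∫ x, φ x • (u t₂ x - u t₁ x) := by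
  intro t₀ u p hp φ hφ hφc t₁ t₂ h₁ h12 h₂
  exact fpl_PIN_intervalIntegral_integral_smul_timeDeriv hp isOpen_Ioo hφ hφc h12
    (fun τ hτ => ⟨h₁.trans_le hτ.1, hτ.2.trans_lt h₂⟩)

end Registered

end Summit.NavierStokesRegularity.NavierStokesRegularity.Theorems

end
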